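import Summits.QuantumFields.YangMills.Theorems.SwapVirialDeficitGnomonicJet
import HarnessLib

/-!
# W4 (order-4 jets), part K1: 4-JETS OF UNIT QUATERNION PATHS — the package `(a, a², 3a³, 9a⁴)` and its closure properties
# (free-hands support of ⟨stmt-QuantumFields-24197⟩ `SwapVirialDeficit.SwapGluedStiffness`)

LEAD g97's steep-window Morse–Bott plan (HOME `sfw-p2-g97-memo-24197-steep-window-morse-bott.md`, §1 (B-bulk)) feeds w2 g58's
✓`laplaceMethod_quantitative_fibred_of_taylor` with FOURTH-ORDER Taylor data of the deficit along the Euler rays `t ↦ F̂(p, t·y)` — brick W4: «jets to ORDER 4 along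
Euler rays, sup-type letter size, constants poly(L)».  The order-3 half is ✓`…GnomonicJet` ∕ `…JetLetters` ∕ `…JetLeaders` ∕ `…JetWords` ∕ `…JetDeficit` ∕
`…EulerRemainderBound` (J1–J4, this seat).  This file is the order-4 twin of J1 (ring-independent, no chart): the package

  «`f : ℝ → ℍ` carries a 4-jet of size `a`» := `∃ f₁ f₂ f₃ f₄, (HasDerivAt chains f → f₁ → f₂ → f₃ → f₄ on ℝ) ∧
     ∀ t, ‖f t‖ ≤ 1 ∧ ‖f₁ t‖ ≤ a ∧ ‖f₂ t‖ ≤ a² ∧ ‖f₃ t‖ ≤ 3a³ ∧ ‖f₄ t‖ ≤ 9a⁴`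

(written out, no `def`; `9a⁴` is the exact fourth jet of a gnomonic letter, part K2), and
* §1 ★ `jet4_const`, `jet4_mono`, `jet4_neg`, `jet4_star`, `jet4_smul`, ★★ `jet4_mul` — PRODUCTS ADD SIZES (Leibniz to order four:
  `9a⁴ + 12a³b + 6a²b² + 12ab³ + 9b⁴ ≤ 9(a+b)⁴`), `jet4_mul3`, `jet3_of_jet4`;
* §2 real parts and sums: ★ `realJet4_re_term` (`c − k·re(w)`: bounds `|k|a, |k|a², 3|k|a³, 9|k|a⁴`), `realJet4_mul_re`, `realJet4_const_sub`, `realJet4_add`,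
  `realJet4_const_mul`, `realJet4_mono`, ★ `realJet4_sum`.

HONEST LABEL: elementary calculus (no ring, no measure); nothing about ⟨24197⟩ (window-uniform, OPEN), (LW), (M), the bulk∕tip programme W3–W9 or any rung is proved;
⟨24194⟩ ∕ ⟨24196⟩ ∕ ⟨24497⟩ OPEN; item of record ⟨24085⟩ SubOctaveBounded aside ∕ untouched; the Yang–Mills mass gap is NOT proved; no summit is proved by a line.
THEOREMS ONLY (0 `def`, 0 `sorry`), standard axioms, no local instances.  Seat ym-line-fcl-p3 g47 (cell ym-idea-1, free hands), `--supports stmt-QuantumFields-24197`.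
References: [folklore] (Leibniz rule).
-/

set_option autoImplicit false

noncomputable section

open Quaternion
open scoped Quaternion BigOperators

namespace Summit.QuantumFields.YangMills.Theorems.SwapVirialDeficit.Gnomonic

/-! ## §1 The 4-jet package and its closure properties -/

/-- ★ A constant path of norm `≤ 1` carries a 4-jet of every size `a ≥ 0`. [folklore] -/
theorem jet4_const (q : ℍ) (hq : ‖q‖ ≤ 1) {a : ℝ} (ha : 0 ≤ a) :
    ∃ f₁ f₂ f₃ f₄ : ℝ → ℍ, (∀ t, HasDerivAt (fun _ : ℝ => q) (f₁ t) t) ∧ (∀ t, HasDerivAt f₁ (f₂ t) t) ∧ (∀ t, HasDerivAt f₂ (f₃ t) t) ∧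
      (∀ t, HasDerivAt f₃ (f₄ t) t) ∧ ∀ t, ‖q‖ ≤ 1 ∧ ‖f₁ t‖ ≤ a ∧ ‖f₂ t‖ ≤ a ^ 2 ∧ ‖f₃ t‖ ≤ 3 * a ^ 3 ∧ ‖f₄ t‖ ≤ 9 * a ^ 4 :=
  ⟨fun _ => 0, fun _ => 0, fun _ => 0, fun _ => 0, fun t => hasDerivAt_const t q, fun t => hasDerivAt_const t 0, fun t => hasDerivAt_const t 0,
    fun t => hasDerivAt_const t 0, fun _ => ⟨hq, by simpa using ha, by simp; positivity, by simp; positivity, by simp; positivity⟩⟩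

/-- ★ Monotonicity in the size. [folklore] -/
theorem jet4_mono {f : ℝ → ℍ} {a b : ℝ} (ha : 0 ≤ a) (hab : a ≤ b)
    (hf : ∃ f₁ f₂ f₃ f₄ : ℝ → ℍ, (∀ t, HasDerivAt f (f₁ t) t) ∧ (∀ t, HasDerivAt f₁ (f₂ t) t) ∧ (∀ t, HasDerivAt f₂ (f₃ t) t) ∧
      (∀ t, HasDerivAt f₃ (f₄ t) t) ∧ ∀ t, ‖f t‖ ≤ 1 ∧ ‖f₁ t‖ ≤ a ∧ ‖f₂ t‖ ≤ a ^ 2 ∧ ‖f₃ t‖ ≤ 3 * a ^ 3 ∧ ‖f₄ t‖ ≤ 9 * a ^ 4) :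
    ∃ f₁ f₂ f₃ f₄ : ℝ → ℍ, (∀ t, HasDerivAt f (f₁ t) t) ∧ (∀ t, HasDerivAt f₁ (f₂ t) t) ∧ (∀ t, HasDerivAt f₂ (f₃ t) t) ∧
      (∀ t, HasDerivAt f₃ (f₄ t) t) ∧ ∀ t, ‖f t‖ ≤ 1 ∧ ‖f₁ t‖ ≤ b ∧ ‖f₂ t‖ ≤ b ^ 2 ∧ ‖f₃ t‖ ≤ 3 * b ^ 3 ∧ ‖f₄ t‖ ≤ 9 * b ^ 4 := by
  obtain ⟨f₁, f₂, f₃, f₄, h₁, h₂, h₃, h₄, hb⟩ := hf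
  refine ⟨f₁, f₂, f₃, f₄, h₁, h₂, h₃, h₄, fun t => ⟨(hb t).1, (hb t).2.1.trans hab, (hb t).2.2.1.trans (pow_le_pow_left₀ ha hab 2),
    (hb t).2.2.2.1.trans (by nlinarith [pow_le_pow_left₀ ha hab 3]), (hb t).2.2.2.2.trans (by nlinarith [pow_le_pow_left₀ ha hab 4])⟩⟩

/-- ★ Negation preserves 4-jets. [folklore] -/
theorem jet4_neg {f : ℝ → ℍ} {a : ℝ}
    (hf : ∃ f₁ f₂ f₃ f₄ : ℝ → ℍ, (∀ t, HasDerivAt f (f₁ t) t) ∧ (∀ t, HasDerivAt f₁ (f₂ t) t) ∧ (∀ t, HasDerivAt f₂ (f₃ t) t) ∧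
      (∀ t, HasDerivAt f₃ (f₄ t) t) ∧ ∀ t, ‖f t‖ ≤ 1 ∧ ‖f₁ t‖ ≤ a ∧ ‖f₂ t‖ ≤ a ^ 2 ∧ ‖f₃ t‖ ≤ 3 * a ^ 3 ∧ ‖f₄ t‖ ≤ 9 * a ^ 4) :
    ∃ g₁ g₂ g₃ g₄ : ℝ → ℍ, (∀ t, HasDerivAt (fun t => -f t) (g₁ t) t) ∧ (∀ t, HasDerivAt g₁ (g₂ t) t) ∧ (∀ t, HasDerivAt g₂ (g₃ t) t) ∧
      (∀ t, HasDerivAt g₃ (g₄ t) t) ∧ ∀ t, ‖-f t‖ ≤ 1 ∧ ‖g₁ t‖ ≤ a ∧ ‖g₂ t‖ ≤ a ^ 2 ∧ ‖g₃ t‖ ≤ 3 * a ^ 3 ∧ ‖g₄ t‖ ≤ 9 * a ^ 4 := by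
  obtain ⟨f₁, f₂, f₃, f₄, h₁, h₂, h₃, h₄, hb⟩ := hf
  refine ⟨fun t => -f₁ t, fun t => -f₂ t, fun t => -f₃ t, fun t => -f₄ t, fun t => (h₁ t).neg, fun t => (h₂ t).neg, fun t => (h₃ t).neg,
    fun t => (h₄ t).neg, fun t => ?_⟩
  simp only [norm_neg]; exact hb t

/-- ★ Conjugation preserves 4-jets. [folklore] -/
theorem jet4_star {f : ℝ → ℍ} {a : ℝ}
    (hf : ∃ f₁ f₂ f₃ f₄ : ℝ → ℍ, (∀ t, HasDerivAt f (f₁ t) t) ∧ (∀ t, HasDerivAt f₁ (f₂ t) t) ∧ (∀ t, HasDerivAt f₂ (f₃ t) t) ∧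
      (∀ t, HasDerivAt f₃ (f₄ t) t) ∧ ∀ t, ‖f t‖ ≤ 1 ∧ ‖f₁ t‖ ≤ a ∧ ‖f₂ t‖ ≤ a ^ 2 ∧ ‖f₃ t‖ ≤ 3 * a ^ 3 ∧ ‖f₄ t‖ ≤ 9 * a ^ 4) :
    ∃ g₁ g₂ g₃ g₄ : ℝ → ℍ, (∀ t, HasDerivAt (fun t => star (f t)) (g₁ t) t) ∧ (∀ t, HasDerivAt g₁ (g₂ t) t) ∧ (∀ t, HasDerivAt g₂ (g₃ t) t) ∧
      (∀ t, HasDerivAt g₃ (g₄ t) t) ∧ ∀ t, ‖star (f t)‖ ≤ 1 ∧ ‖g₁ t‖ ≤ a ∧ ‖g₂ t‖ ≤ a ^ 2 ∧ ‖g₃ t‖ ≤ 3 * a ^ 3 ∧ ‖g₄ t‖ ≤ 9 * a ^ 4 := by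
  obtain ⟨f₁, f₂, f₃, f₄, h₁, h₂, h₃, h₄, hb⟩ := hf
  refine ⟨fun t => star (f₁ t), fun t => star (f₂ t), fun t => star (f₃ t), fun t => star (f₄ t), fun t => hasDerivAt_quatStar (h₁ t),
    fun t => hasDerivAt_quatStar (h₂ t), fun t => hasDerivAt_quatStar (h₃ t), fun t => hasDerivAt_quatStar (h₄ t), fun t => ?_⟩
  simp only [Quaternion.norm_star]; exact hb t

/-- ★ A real sign `c`, `|c| = 1`, preserves 4-jets. [folklore] -/
theorem jet4_smul {f : ℝ → ℍ} {a c : ℝ} (hc : |c| = 1)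
    (hf : ∃ f₁ f₂ f₃ f₄ : ℝ → ℍ, (∀ t, HasDerivAt f (f₁ t) t) ∧ (∀ t, HasDerivAt f₁ (f₂ t) t) ∧ (∀ t, HasDerivAt f₂ (f₃ t) t) ∧
      (∀ t, HasDerivAt f₃ (f₄ t) t) ∧ ∀ t, ‖f t‖ ≤ 1 ∧ ‖f₁ t‖ ≤ a ∧ ‖f₂ t‖ ≤ a ^ 2 ∧ ‖f₃ t‖ ≤ 3 * a ^ 3 ∧ ‖f₄ t‖ ≤ 9 * a ^ 4) :
    ∃ g₁ g₂ g₃ g₄ : ℝ → ℍ, (∀ t, HasDerivAt (fun t => c • f t) (g₁ t) t) ∧ (∀ t, HasDerivAt g₁ (g₂ t) t) ∧ (∀ t, HasDerivAt g₂ (g₃ t) t) ∧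
      (∀ t, HasDerivAt g₃ (g₄ t) t) ∧ ∀ t, ‖c • f t‖ ≤ 1 ∧ ‖g₁ t‖ ≤ a ∧ ‖g₂ t‖ ≤ a ^ 2 ∧ ‖g₃ t‖ ≤ 3 * a ^ 3 ∧ ‖g₄ t‖ ≤ 9 * a ^ 4 := by
  obtain ⟨f₁, f₂, f₃, f₄, h₁, h₂, h₃, h₄, hb⟩ := hf
  refine ⟨fun t => c • f₁ t, fun t => c • f₂ t, fun t => c • f₃ t, fun t => c • f₄ t, fun t => (h₁ t).const_smul c, fun t => (h₂ t).const_smul c,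
    fun t => (h₃ t).const_smul c, fun t => (h₄ t).const_smul c, fun t => ?_⟩
  simp only [norm_smul, Real.norm_eq_abs, hc, one_mul]; exact hb t

/-- ★★ **PRODUCTS ADD SIZES** (Leibniz to order four): sizes `a, b ≥ 0` give size `a + b` — fourth `9a⁴ + 4·3a³b + 6a²b² + 4a·3b³ + 9b⁴ ≤ 9(a+b)⁴`.
[folklore] -/
theorem jet4_mul {f g : ℝ → ℍ} {a b : ℝ} (ha : 0 ≤ a) (hb : 0 ≤ b)
    (hf : ∃ f₁ f₂ f₃ f₄ : ℝ → ℍ, (∀ t, HasDerivAt f (f₁ t) t) ∧ (∀ t, HasDerivAt f₁ (f₂ t) t) ∧ (∀ t, HasDerivAt f₂ (f₃ t) t) ∧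
      (∀ t, HasDerivAt f₃ (f₄ t) t) ∧ ∀ t, ‖f t‖ ≤ 1 ∧ ‖f₁ t‖ ≤ a ∧ ‖f₂ t‖ ≤ a ^ 2 ∧ ‖f₃ t‖ ≤ 3 * a ^ 3 ∧ ‖f₄ t‖ ≤ 9 * a ^ 4)
    (hg : ∃ g₁ g₂ g₃ g₄ : ℝ → ℍ, (∀ t, HasDerivAt g (g₁ t) t) ∧ (∀ t, HasDerivAt g₁ (g₂ t) t) ∧ (∀ t, HasDerivAt g₂ (g₃ t) t) ∧
      (∀ t, HasDerivAt g₃ (g₄ t) t) ∧ ∀ t, ‖g t‖ ≤ 1 ∧ ‖g₁ t‖ ≤ b ∧ ‖g₂ t‖ ≤ b ^ 2 ∧ ‖g₃ t‖ ≤ 3 * b ^ 3 ∧ ‖g₄ t‖ ≤ 9 * b ^ 4) :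
    ∃ p₁ p₂ p₃ p₄ : ℝ → ℍ, (∀ t, HasDerivAt (fun t => f t * g t) (p₁ t) t) ∧ (∀ t, HasDerivAt p₁ (p₂ t) t) ∧ (∀ t, HasDerivAt p₂ (p₃ t) t) ∧
      (∀ t, HasDerivAt p₃ (p₄ t) t) ∧
      ∀ t, ‖f t * g t‖ ≤ 1 ∧ ‖p₁ t‖ ≤ a + b ∧ ‖p₂ t‖ ≤ (a + b) ^ 2 ∧ ‖p₃ t‖ ≤ 3 * (a + b) ^ 3 ∧ ‖p₄ t‖ ≤ 9 * (a + b) ^ 4 := by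
  obtain ⟨f₁, f₂, f₃, f₄, hf₁, hf₂, hf₃, hf₄, nf⟩ := hf
  obtain ⟨g₁, g₂, g₃, g₄, hg₁, hg₂, hg₃, hg₄, ng⟩ := hg
  refine ⟨fun t => f₁ t * g t + f t * g₁ t,
    fun t => (f₂ t * g t + f₁ t * g₁ t) + (f₁ t * g₁ t + f t * g₂ t),
    fun t => ((f₃ t * g t + f₂ t * g₁ t) + (f₂ t * g₁ t + f₁ t * g₂ t)) + ((f₂ t * g₁ t + f₁ t * g₂ t) + (f₁ t * g₂ t + f t * g₃ t)),
    fun t => (((f₄ t * g t + f₃ t * g₁ t) + (f₃ t * g₁ t + f₂ t * g₂ t)) + ((f₃ t * g₁ t + f₂ t * g₂ t) + (f₂ t * g₂ t + f₁ t * g₃ t))) +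
      (((f₃ t * g₁ t + f₂ t * g₂ t) + (f₂ t * g₂ t + f₁ t * g₃ t)) + ((f₂ t * g₂ t + f₁ t * g₃ t) + (f₁ t * g₃ t + f t * g₄ t))),
    fun t => (hf₁ t).mul (hg₁ t),
    fun t => ((hf₂ t).mul (hg₁ t)).add ((hf₁ t).mul (hg₂ t)),
    fun t => (((hf₃ t).mul (hg₁ t)).add ((hf₂ t).mul (hg₂ t))).add (((hf₂ t).mul (hg₂ t)).add ((hf₁ t).mul (hg₃ t))),
    fun t => ((((hf₄ t).mul (hg₁ t)).add ((hf₃ t).mul (hg₂ t))).add (((hf₃ t).mul (hg₂ t)).add ((hf₂ t).mul (hg₃ t)))).add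
      ((((hf₃ t).mul (hg₂ t)).add ((hf₂ t).mul (hg₃ t))).add (((hf₂ t).mul (hg₃ t)).add ((hf₁ t).mul (hg₄ t)))),
    fun t => ?_⟩
  obtain ⟨n0, n1, n2, n3, n4⟩ := nf t
  obtain ⟨m0, m1, m2, m3, m4⟩ := ng t
  have ha2 : 0 ≤ a ^ 2 := by positivity
  have ha3 : 0 ≤ 3 * a ^ 3 := by positivity
  have ha4 : 0 ≤ 9 * a ^ 4 := by positivity
  have e00 := norm_mul_le_of_le n0 m0 zero_le_one
  have e10 := norm_mul_le_of_le n1 m0 ha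
  have e01 := norm_mul_le_of_le n0 m1 zero_le_one
  have e20 := norm_mul_le_of_le n2 m0 ha2
  have e11 := norm_mul_le_of_le n1 m1 ha
  have e02 := norm_mul_le_of_le n0 m2 zero_le_one
  have e30 := norm_mul_le_of_le n3 m0 ha3
  have e21 := norm_mul_le_of_le n2 m1 ha2
  have e12 := norm_mul_le_of_le n1 m2 ha
  have e03 := norm_mul_le_of_le n0 m3 zero_le_one
  have e40 := norm_mul_le_of_le n4 m0 ha4
  have e31 := norm_mul_le_of_le n3 m1 ha3
  have e22 := norm_mul_le_of_le n2 m2 ha2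
  have e13 := norm_mul_le_of_le n1 m3 ha
  have e04 := norm_mul_le_of_le n0 m4 zero_le_one
  have hab3 : 0 ≤ a * b := mul_nonneg ha hb
  refine ⟨by simpa using e00, ?_, ?_, ?_, ?_⟩
  · exact (norm_add_le_of_le e10 e01).trans (by nlinarith)
  · exact (norm_add_le_of_le (norm_add_le_of_le e20 e11) (norm_add_le_of_le e11 e02)).trans (by nlinarith)
  · exact (norm_add_le_of_le (norm_add_le_of_le (norm_add_le_of_le e30 e21) (norm_add_le_of_le e21 e12))
      (norm_add_le_of_le (norm_add_le_of_le e21 e12) (norm_add_le_of_le e12 e03))).trans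
      (by nlinarith [mul_nonneg (mul_nonneg ha ha) hb, mul_nonneg (mul_nonneg ha hb) hb])
  · exact (norm_add_le_of_le
      (norm_add_le_of_le (norm_add_le_of_le (norm_add_le_of_le e40 e31) (norm_add_le_of_le e31 e22))
        (norm_add_le_of_le (norm_add_le_of_le e31 e22) (norm_add_le_of_le e22 e13)))
      (norm_add_le_of_le (norm_add_le_of_le (norm_add_le_of_le e31 e22) (norm_add_le_of_le e22 e13))
        (norm_add_le_of_le (norm_add_le_of_le e22 e13) (norm_add_le_of_le e13 e04)))).trans
      (by nlinarith [mul_nonneg (mul_nonneg (mul_nonneg ha ha) ha) hb, mul_nonneg (mul_nonneg (mul_nonneg ha ha) hb) hb,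
        mul_nonneg (mul_nonneg (mul_nonneg ha hb) hb) hb])

/-- ★ Three factors: sizes `a, b, c` give size `a + b + c`. [folklore] -/
theorem jet4_mul3 {f g h : ℝ → ℍ} {a b c : ℝ} (ha : 0 ≤ a) (hb : 0 ≤ b) (hc : 0 ≤ c)
    (hf : ∃ f₁ f₂ f₃ f₄ : ℝ → ℍ, (∀ t, HasDerivAt f (f₁ t) t) ∧ (∀ t, HasDerivAt f₁ (f₂ t) t) ∧ (∀ t, HasDerivAt f₂ (f₃ t) t) ∧
      (∀ t, HasDerivAt f₃ (f₄ t) t) ∧ ∀ t, ‖f t‖ ≤ 1 ∧ ‖f₁ t‖ ≤ a ∧ ‖f₂ t‖ ≤ a ^ 2 ∧ ‖f₃ t‖ ≤ 3 * a ^ 3 ∧ ‖f₄ t‖ ≤ 9 * a ^ 4)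
    (hg : ∃ g₁ g₂ g₃ g₄ : ℝ → ℍ, (∀ t, HasDerivAt g (g₁ t) t) ∧ (∀ t, HasDerivAt g₁ (g₂ t) t) ∧ (∀ t, HasDerivAt g₂ (g₃ t) t) ∧
      (∀ t, HasDerivAt g₃ (g₄ t) t) ∧ ∀ t, ‖g t‖ ≤ 1 ∧ ‖g₁ t‖ ≤ b ∧ ‖g₂ t‖ ≤ b ^ 2 ∧ ‖g₃ t‖ ≤ 3 * b ^ 3 ∧ ‖g₄ t‖ ≤ 9 * b ^ 4)
    (hh : ∃ h₁ h₂ h₃ h₄ : ℝ → ℍ, (∀ t, HasDerivAt h (h₁ t) t) ∧ (∀ t, HasDerivAt h₁ (h₂ t) t) ∧ (∀ t, HasDerivAt h₂ (h₃ t) t) ∧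
      (∀ t, HasDerivAt h₃ (h₄ t) t) ∧ ∀ t, ‖h t‖ ≤ 1 ∧ ‖h₁ t‖ ≤ c ∧ ‖h₂ t‖ ≤ c ^ 2 ∧ ‖h₃ t‖ ≤ 3 * c ^ 3 ∧ ‖h₄ t‖ ≤ 9 * c ^ 4) :
    ∃ p₁ p₂ p₃ p₄ : ℝ → ℍ, (∀ t, HasDerivAt (fun t => f t * g t * h t) (p₁ t) t) ∧ (∀ t, HasDerivAt p₁ (p₂ t) t) ∧ (∀ t, HasDerivAt p₂ (p₃ t) t) ∧
      (∀ t, HasDerivAt p₃ (p₄ t) t) ∧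
      ∀ t, ‖f t * g t * h t‖ ≤ 1 ∧ ‖p₁ t‖ ≤ a + b + c ∧ ‖p₂ t‖ ≤ (a + b + c) ^ 2 ∧ ‖p₃ t‖ ≤ 3 * (a + b + c) ^ 3 ∧ ‖p₄ t‖ ≤ 9 * (a + b + c) ^ 4 :=
  jet4_mul (f := fun t => f t * g t) (add_nonneg ha hb) hc (jet4_mul ha hb hf hg) hh

/-- Forgetting the fourth derivative: a 4-jet of size `a` is a 3-jet of size `a` (J1's package). [folklore] -/
theorem jet3_of_jet4 {f : ℝ → ℍ} {a : ℝ}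
    (hf : ∃ f₁ f₂ f₃ f₄ : ℝ → ℍ, (∀ t, HasDerivAt f (f₁ t) t) ∧ (∀ t, HasDerivAt f₁ (f₂ t) t) ∧ (∀ t, HasDerivAt f₂ (f₃ t) t) ∧
      (∀ t, HasDerivAt f₃ (f₄ t) t) ∧ ∀ t, ‖f t‖ ≤ 1 ∧ ‖f₁ t‖ ≤ a ∧ ‖f₂ t‖ ≤ a ^ 2 ∧ ‖f₃ t‖ ≤ 3 * a ^ 3 ∧ ‖f₄ t‖ ≤ 9 * a ^ 4) :
    ∃ f₁ f₂ f₃ : ℝ → ℍ, (∀ t, HasDerivAt f (f₁ t) t) ∧ (∀ t, HasDerivAt f₁ (f₂ t) t) ∧ (∀ t, HasDerivAt f₂ (f₃ t) t) ∧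
      ∀ t, ‖f t‖ ≤ 1 ∧ ‖f₁ t‖ ≤ a ∧ ‖f₂ t‖ ≤ a ^ 2 ∧ ‖f₃ t‖ ≤ 3 * a ^ 3 := by
  obtain ⟨f₁, f₂, f₃, f₄, h₁, h₂, h₃, -, hb⟩ := hf
  exact ⟨f₁, f₂, f₃, h₁, h₂, h₃, fun t => ⟨(hb t).1, (hb t).2.1, (hb t).2.2.1, (hb t).2.2.2.1⟩⟩

/-! ## §2 Real parts and finite sums -/

/-- ★ **The real term `c − k·re(w(t))`** along a path carrying a 4-jet of size `a`: four derivatives, bounded by `|k|a, |k|a², 3|k|a³, 9|k|a⁴`. [folklore] -/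
theorem realJet4_re_term {w : ℝ → ℍ} {a : ℝ} (c k : ℝ)
    (hw : ∃ w₁ w₂ w₃ w₄ : ℝ → ℍ, (∀ t, HasDerivAt w (w₁ t) t) ∧ (∀ t, HasDerivAt w₁ (w₂ t) t) ∧ (∀ t, HasDerivAt w₂ (w₃ t) t) ∧
      (∀ t, HasDerivAt w₃ (w₄ t) t) ∧ ∀ t, ‖w t‖ ≤ 1 ∧ ‖w₁ t‖ ≤ a ∧ ‖w₂ t‖ ≤ a ^ 2 ∧ ‖w₃ t‖ ≤ 3 * a ^ 3 ∧ ‖w₄ t‖ ≤ 9 * a ^ 4) :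
    ∃ d₁ d₂ d₃ d₄ : ℝ → ℝ, (∀ t, HasDerivAt (fun t => c - k * (w t).re) (d₁ t) t) ∧ (∀ t, HasDerivAt d₁ (d₂ t) t) ∧ (∀ t, HasDerivAt d₂ (d₃ t) t) ∧
      (∀ t, HasDerivAt d₃ (d₄ t) t) ∧
      ∀ t, |d₁ t| ≤ |k| * a ∧ |d₂ t| ≤ |k| * a ^ 2 ∧ |d₃ t| ≤ |k| * (3 * a ^ 3) ∧ |d₄ t| ≤ |k| * (9 * a ^ 4) := by
  obtain ⟨w₁, w₂, w₃, w₄, h₁, h₂, h₃, h₄, hb⟩ := hw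
  refine ⟨fun t => -(k * (w₁ t).re), fun t => -(k * (w₂ t).re), fun t => -(k * (w₃ t).re), fun t => -(k * (w₄ t).re), fun t => ?_, fun t => ?_,
    fun t => ?_, fun t => ?_, fun t => ?_⟩
  · have h := ((hasDerivAt_re (h₁ t)).const_mul k).const_sub c
    simpa using h
  · exact ((hasDerivAt_re (h₂ t)).const_mul k).neg
  · exact ((hasDerivAt_re (h₃ t)).const_mul k).neg
  · exact ((hasDerivAt_re (h₄ t)).const_mul k).neg
  · have r1 := (Literature.MathematicalPhysics.QuantumLattice.abs_re_le_norm (w₁ t)).trans (hb t).2.1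
    have r2 := (Literature.MathematicalPhysics.QuantumLattice.abs_re_le_norm (w₂ t)).trans (hb t).2.2.1
    have r3 := (Literature.MathematicalPhysics.QuantumLattice.abs_re_le_norm (w₃ t)).trans (hb t).2.2.2.1
    have r4 := (Literature.MathematicalPhysics.QuantumLattice.abs_re_le_norm (w₄ t)).trans (hb t).2.2.2.2
    simp only [abs_neg, abs_mul]
    exact ⟨mul_le_mul_of_nonneg_left r1 (abs_nonneg k), mul_le_mul_of_nonneg_left r2 (abs_nonneg k), mul_le_mul_of_nonneg_left r3 (abs_nonneg k),
      mul_le_mul_of_nonneg_left r4 (abs_nonneg k)⟩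

/-- ★ The real term `k·re(w(t))`: bounds `|k|a, |k|a², 3|k|a³, 9|k|a⁴`. [folklore] -/
theorem realJet4_mul_re {w : ℝ → ℍ} {a : ℝ} (k : ℝ)
    (hw : ∃ w₁ w₂ w₃ w₄ : ℝ → ℍ, (∀ t, HasDerivAt w (w₁ t) t) ∧ (∀ t, HasDerivAt w₁ (w₂ t) t) ∧ (∀ t, HasDerivAt w₂ (w₃ t) t) ∧
      (∀ t, HasDerivAt w₃ (w₄ t) t) ∧ ∀ t, ‖w t‖ ≤ 1 ∧ ‖w₁ t‖ ≤ a ∧ ‖w₂ t‖ ≤ a ^ 2 ∧ ‖w₃ t‖ ≤ 3 * a ^ 3 ∧ ‖w₄ t‖ ≤ 9 * a ^ 4) :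
    ∃ d₁ d₂ d₃ d₄ : ℝ → ℝ, (∀ t, HasDerivAt (fun t => k * (w t).re) (d₁ t) t) ∧ (∀ t, HasDerivAt d₁ (d₂ t) t) ∧ (∀ t, HasDerivAt d₂ (d₃ t) t) ∧
      (∀ t, HasDerivAt d₃ (d₄ t) t) ∧
      ∀ t, |d₁ t| ≤ |k| * a ∧ |d₂ t| ≤ |k| * a ^ 2 ∧ |d₃ t| ≤ |k| * (3 * a ^ 3) ∧ |d₄ t| ≤ |k| * (9 * a ^ 4) := by
  obtain ⟨d₁, d₂, d₃, d₄, e₁, e₂, e₃, e₄, hb⟩ := realJet4_re_term 0 (-k) hw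
  refine ⟨d₁, d₂, d₃, d₄, fun t => ?_, e₂, e₃, e₄, fun t => by simpa only [abs_neg] using hb t⟩
  have h := e₁ t
  simp only [neg_mul, zero_sub, neg_neg] at h
  exact h

/-- `c − φ` carries the same real 4-jet bounds as `φ`. [folklore] -/
theorem realJet4_const_sub {φ : ℝ → ℝ} {M₁ M₂ M₃ M₄ : ℝ} (c : ℝ)
    (hφ : ∃ d₁ d₂ d₃ d₄ : ℝ → ℝ, (∀ t, HasDerivAt φ (d₁ t) t) ∧ (∀ t, HasDerivAt d₁ (d₂ t) t) ∧ (∀ t, HasDerivAt d₂ (d₃ t) t) ∧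
      (∀ t, HasDerivAt d₃ (d₄ t) t) ∧ ∀ t, |d₁ t| ≤ M₁ ∧ |d₂ t| ≤ M₂ ∧ |d₃ t| ≤ M₃ ∧ |d₄ t| ≤ M₄) :
    ∃ d₁ d₂ d₃ d₄ : ℝ → ℝ, (∀ t, HasDerivAt (fun t => c - φ t) (d₁ t) t) ∧ (∀ t, HasDerivAt d₁ (d₂ t) t) ∧ (∀ t, HasDerivAt d₂ (d₃ t) t) ∧
      (∀ t, HasDerivAt d₃ (d₄ t) t) ∧ ∀ t, |d₁ t| ≤ M₁ ∧ |d₂ t| ≤ M₂ ∧ |d₃ t| ≤ M₃ ∧ |d₄ t| ≤ M₄ := by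
  obtain ⟨d₁, d₂, d₃, d₄, e₁, e₂, e₃, e₄, hb⟩ := hφ
  refine ⟨fun t => -d₁ t, fun t => -d₂ t, fun t => -d₃ t, fun t => -d₄ t, fun t => ?_, fun t => (e₂ t).neg, fun t => (e₃ t).neg,
    fun t => (e₄ t).neg, fun t => ?_⟩
  · have h := (e₁ t).const_sub c
    simpa using h
  · simp only [abs_neg]; exact hb t

/-- ★ Sums of two real 4-jets: the bounds add. [folklore] -/
theorem realJet4_add {φ ψ : ℝ → ℝ} {M₁ M₂ M₃ M₄ N₁ N₂ N₃ N₄ : ℝ}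
    (hφ : ∃ d₁ d₂ d₃ d₄ : ℝ → ℝ, (∀ t, HasDerivAt φ (d₁ t) t) ∧ (∀ t, HasDerivAt d₁ (d₂ t) t) ∧ (∀ t, HasDerivAt d₂ (d₃ t) t) ∧
      (∀ t, HasDerivAt d₃ (d₄ t) t) ∧ ∀ t, |d₁ t| ≤ M₁ ∧ |d₂ t| ≤ M₂ ∧ |d₃ t| ≤ M₃ ∧ |d₄ t| ≤ M₄)
    (hψ : ∃ d₁ d₂ d₃ d₄ : ℝ → ℝ, (∀ t, HasDerivAt ψ (d₁ t) t) ∧ (∀ t, HasDerivAt d₁ (d₂ t) t) ∧ (∀ t, HasDerivAt d₂ (d₃ t) t) ∧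
      (∀ t, HasDerivAt d₃ (d₄ t) t) ∧ ∀ t, |d₁ t| ≤ N₁ ∧ |d₂ t| ≤ N₂ ∧ |d₃ t| ≤ N₃ ∧ |d₄ t| ≤ N₄) :
    ∃ d₁ d₂ d₃ d₄ : ℝ → ℝ, (∀ t, HasDerivAt (fun t => φ t + ψ t) (d₁ t) t) ∧ (∀ t, HasDerivAt d₁ (d₂ t) t) ∧ (∀ t, HasDerivAt d₂ (d₃ t) t) ∧
      (∀ t, HasDerivAt d₃ (d₄ t) t) ∧ ∀ t, |d₁ t| ≤ M₁ + N₁ ∧ |d₂ t| ≤ M₂ + N₂ ∧ |d₃ t| ≤ M₃ + N₃ ∧ |d₄ t| ≤ M₄ + N₄ := by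
  obtain ⟨p₁, p₂, p₃, p₄, hp₁, hp₂, hp₃, hp₄, bp⟩ := hφ
  obtain ⟨q₁, q₂, q₃, q₄, hq₁, hq₂, hq₃, hq₄, bq⟩ := hψ
  refine ⟨fun t => p₁ t + q₁ t, fun t => p₂ t + q₂ t, fun t => p₃ t + q₃ t, fun t => p₄ t + q₄ t, fun t => (hp₁ t).add (hq₁ t),
    fun t => (hp₂ t).add (hq₂ t), fun t => (hp₃ t).add (hq₃ t), fun t => (hp₄ t).add (hq₄ t), fun t => ⟨?_, ?_, ?_, ?_⟩⟩
  · exact (abs_add_le _ _).trans (add_le_add (bp t).1 (bq t).1)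
  · exact (abs_add_le _ _).trans (add_le_add (bp t).2.1 (bq t).2.1)
  · exact (abs_add_le _ _).trans (add_le_add (bp t).2.2.1 (bq t).2.2.1)
  · exact (abs_add_le _ _).trans (add_le_add (bp t).2.2.2 (bq t).2.2.2)

/-- ★ A constant multiple of a real 4-jet. [folklore] -/
theorem realJet4_const_mul {φ : ℝ → ℝ} {M₁ M₂ M₃ M₄ : ℝ} (k : ℝ)
    (hφ : ∃ d₁ d₂ d₃ d₄ : ℝ → ℝ, (∀ t, HasDerivAt φ (d₁ t) t) ∧ (∀ t, HasDerivAt d₁ (d₂ t) t) ∧ (∀ t, HasDerivAt d₂ (d₃ t) t) ∧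
      (∀ t, HasDerivAt d₃ (d₄ t) t) ∧ ∀ t, |d₁ t| ≤ M₁ ∧ |d₂ t| ≤ M₂ ∧ |d₃ t| ≤ M₃ ∧ |d₄ t| ≤ M₄) :
    ∃ d₁ d₂ d₃ d₄ : ℝ → ℝ, (∀ t, HasDerivAt (fun t => k * φ t) (d₁ t) t) ∧ (∀ t, HasDerivAt d₁ (d₂ t) t) ∧ (∀ t, HasDerivAt d₂ (d₃ t) t) ∧
      (∀ t, HasDerivAt d₃ (d₄ t) t) ∧ ∀ t, |d₁ t| ≤ |k| * M₁ ∧ |d₂ t| ≤ |k| * M₂ ∧ |d₃ t| ≤ |k| * M₃ ∧ |d₄ t| ≤ |k| * M₄ := by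
  obtain ⟨p₁, p₂, p₃, p₄, hp₁, hp₂, hp₃, hp₄, bp⟩ := hφ
  refine ⟨fun t => k * p₁ t, fun t => k * p₂ t, fun t => k * p₃ t, fun t => k * p₄ t, fun t => (hp₁ t).const_mul k, fun t => (hp₂ t).const_mul k,
    fun t => (hp₃ t).const_mul k, fun t => (hp₄ t).const_mul k, fun t => ?_⟩
  simp only [abs_mul]
  exact ⟨mul_le_mul_of_nonneg_left (bp t).1 (abs_nonneg k), mul_le_mul_of_nonneg_left (bp t).2.1 (abs_nonneg k),
    mul_le_mul_of_nonneg_left (bp t).2.2.1 (abs_nonneg k), mul_le_mul_of_nonneg_left (bp t).2.2.2 (abs_nonneg k)⟩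

/-- Weakening the bounds of a real 4-jet. [folklore] -/
theorem realJet4_mono {φ : ℝ → ℝ} {M₁ M₂ M₃ M₄ N₁ N₂ N₃ N₄ : ℝ} (h₁ : M₁ ≤ N₁) (h₂ : M₂ ≤ N₂) (h₃ : M₃ ≤ N₃) (h₄ : M₄ ≤ N₄)
    (hφ : ∃ d₁ d₂ d₃ d₄ : ℝ → ℝ, (∀ t, HasDerivAt φ (d₁ t) t) ∧ (∀ t, HasDerivAt d₁ (d₂ t) t) ∧ (∀ t, HasDerivAt d₂ (d₃ t) t) ∧
      (∀ t, HasDerivAt d₃ (d₄ t) t) ∧ ∀ t, |d₁ t| ≤ M₁ ∧ |d₂ t| ≤ M₂ ∧ |d₃ t| ≤ M₃ ∧ |d₄ t| ≤ M₄) :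
    ∃ d₁ d₂ d₃ d₄ : ℝ → ℝ, (∀ t, HasDerivAt φ (d₁ t) t) ∧ (∀ t, HasDerivAt d₁ (d₂ t) t) ∧ (∀ t, HasDerivAt d₂ (d₃ t) t) ∧
      (∀ t, HasDerivAt d₃ (d₄ t) t) ∧ ∀ t, |d₁ t| ≤ N₁ ∧ |d₂ t| ≤ N₂ ∧ |d₃ t| ≤ N₃ ∧ |d₄ t| ≤ N₄ := by
  obtain ⟨d₁, d₂, d₃, d₄, e₁, e₂, e₃, e₄, hb⟩ := hφ
  exact ⟨d₁, d₂, d₃, d₄, e₁, e₂, e₃, e₄, fun t => ⟨(hb t).1.trans h₁, (hb t).2.1.trans h₂, (hb t).2.2.1.trans h₃, (hb t).2.2.2.trans h₄⟩⟩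

/-- ★ **FINITE SUMS ADD THE BOUNDS** (order four). [folklore] -/
theorem realJet4_sum {ι : Type*} [Fintype ι] {φ : ι → ℝ → ℝ} {M₁ M₂ M₃ M₄ : ι → ℝ}
    (h : ∀ i, ∃ d₁ d₂ d₃ d₄ : ℝ → ℝ, (∀ t, HasDerivAt (φ i) (d₁ t) t) ∧ (∀ t, HasDerivAt d₁ (d₂ t) t) ∧ (∀ t, HasDerivAt d₂ (d₃ t) t) ∧
      (∀ t, HasDerivAt d₃ (d₄ t) t) ∧ ∀ t, |d₁ t| ≤ M₁ i ∧ |d₂ t| ≤ M₂ i ∧ |d₃ t| ≤ M₃ i ∧ |d₄ t| ≤ M₄ i) :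
    ∃ d₁ d₂ d₃ d₄ : ℝ → ℝ, (∀ t, HasDerivAt (fun t => ∑ i, φ i t) (d₁ t) t) ∧ (∀ t, HasDerivAt d₁ (d₂ t) t) ∧ (∀ t, HasDerivAt d₂ (d₃ t) t) ∧
      (∀ t, HasDerivAt d₃ (d₄ t) t) ∧ ∀ t, |d₁ t| ≤ ∑ i, M₁ i ∧ |d₂ t| ≤ ∑ i, M₂ i ∧ |d₃ t| ≤ ∑ i, M₃ i ∧ |d₄ t| ≤ ∑ i, M₄ i := by
  choose d₁ d₂ d₃ d₄ h₁ h₂ h₃ h₄ hb using h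
  refine ⟨fun t => ∑ i, d₁ i t, fun t => ∑ i, d₂ i t, fun t => ∑ i, d₃ i t, fun t => ∑ i, d₄ i t, fun t => ?_, fun t => ?_, fun t => ?_, fun t => ?_,
    fun t => ⟨?_, ?_, ?_, ?_⟩⟩
  · have hs := HasDerivAt.fun_sum (u := Finset.univ) fun i _ => h₁ i t
    simpa using hs
  · have hs := HasDerivAt.fun_sum (u := Finset.univ) fun i _ => h₂ i t
    convert hs using 1
  · have hs := HasDerivAt.fun_sum (u := Finset.univ) fun i _ => h₃ i t
    convert hs using 1
  · have hs := HasDerivAt.fun_sum (u := Finset.univ) fun i _ => h₄ i t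
    convert hs using 1
  · exact (Finset.abs_sum_le_sum_abs _ _).trans (Finset.sum_le_sum fun i _ => (hb i t).1)
  · exact (Finset.abs_sum_le_sum_abs _ _).trans (Finset.sum_le_sum fun i _ => (hb i t).2.1)
  · exact (Finset.abs_sum_le_sum_abs _ _).trans (Finset.sum_le_sum fun i _ => (hb i t).2.2.1)
  · exact (Finset.abs_sum_le_sum_abs _ _).trans (Finset.sum_le_sum fun i _ => (hb i t).2.2.2)

end Summit.QuantumFields.YangMills.Theorems.SwapVirialDeficit.Gnomonic

end
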